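import Summits.QuantumFields.YangMills.Theorems.LuscherReductionRunningReductionExplicitNoIntruder
import HarnessLib

/-!
# Crux RED, line «KTR» rev 3: the fine no-intruder law at `k = 1` (hence `ExplicitNoIntruder 1`) + `0 < ε₁` ⟹ the qualitative leaf `FemtoGapSU2`

Support module (fleet service by seat ym-infvol-p2; owner ym-beyond-p1 g17 memo `OWNER-MEMO-3a-g17.md` §2b, STAFFING ASK (δ), ym-fleet bus
2026-08-27T04:01:33Z) for crux `RunningReduction` (route `LuscherReduction`, item stmt-QuantumFields-19978).  The owner's OBSERVATION, kernel-checked on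
the Theorems side: KT's stub 3 (Lüscher's law from below with relative error `o(1)`) at the SINGLE level `k = 1`, together with `0 < ε₁` (half of the
tree's named fact `LuscherSimonGap`), already gives the QUALITATIVE femto-gap leaf `FemtoGapSU2` (`λ₁ ≤ e^{−c/L}λ₀` eventually, throughout the window) —
WITHOUT the Kato–Temple door, the dressed Ritz family or crux ONE.  Hence so does `ExplicitNoIntruder 1` (via the glue
`levelValue_le_of_explicitNoIntruder`).  The rung of record `FemtoGapOfRecord` (precision `ε₁λ − Cλ²`) is what needs the rest of «KTR» + ONE; no route
targets `FemtoGapSU2` today (owner observation, not a route edit).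

HONEST FRAMING: femto rung R2b1 bookkeeping; `ExplicitNoIntruder 1` and stub 3 are OPEN (XL); nothing here is infinite volume, a mass gap or Clay.
References: [cite: Luscher1983]; [cite: LuscherMunster1984]; [cite: SimonB1983DiscreteSpectrum].
-/

set_option autoImplicit false

noncomputable section

open MeasureTheory Filter Topology Real
open Literature.MathematicalPhysics.QuantumFieldTheory
open Literature.MathematicalPhysics.QuantumLattice
open Literature.Analysis.OperatorTheory.YMMatrixModel

namespace Summit.QuantumFields.YangMills.Theorems.FemtoTransferGap

/-! ## The seam: stub 3 at `k = 1` + `0 < ε₁` ⟹ the qualitative leaf `FemtoGapSU2` -/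

/-- **Seam (PROVED): Lüscher's law from below at `k = 1` with relative error `o(1)` + `0 < ε₁` ⟹ `FemtoGapSU2`.**  `levelGap 1 = luscherEps1`
definitionally; take `d = ε₁/2` and `c = ε₁·lam/2`; on the window `λ(β,L) ≥ lam`.  So KT's stub 3 at `k = 1` ALONE (no Kato–Temple door, no dressed
Ritz family, no crux ONE) reaches the QUALITATIVE leaf `FemtoGapSU2`; the rung of record `FemtoGapOfRecord` (precision `ε₁λ − Cλ²`) is what needs the
rest of «KTR» (memo §2b). [cite: Luscher1983] -/
theorem femtoGapSU2_of_levelOne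
    (h : ∀ d : ℝ, d < levelGap 1 → ∃ lam0 : ℝ, 0 < lam0 ∧ ∀ lam : ℝ, 0 < lam → lam ≤ lam0 →
      ∃ L0 : ℕ, ∀ (L : ℕ) [NeZero L], L0 ≤ L → ∀ β : ℝ, InFemtoWindow lam β L →
        levelValue su2Rep L β 1 ≤ Real.exp (-(d * luscherLambda β L) / L) * levelValue su2Rep L β 0)
    (hε : 0 < luscherEps1) : FemtoGapSU2 := by
  have hgap : levelGap 1 = luscherEps1 := rfl
  obtain ⟨lam0, hlam0, H⟩ := h (luscherEps1 / 2) (by rw [hgap]; linarith)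
  refine ⟨lam0, hlam0, fun lam hlam hle => ?_⟩
  obtain ⟨L0, HL⟩ := H lam hlam hle
  refine ⟨luscherEps1 * lam / 2, by positivity, L0, fun L _ hL0 β hw => ?_⟩
  have key := HL L hL0 β hw
  have hL : (0 : ℝ) < L := Nat.cast_pos.mpr (Nat.pos_of_ne_zero (NeZero.ne L))
  have hwin : lam ≤ luscherLambda β L := hw.2.1
  have hexp : Real.exp (-(luscherEps1 / 2 * luscherLambda β L) / L) ≤ Real.exp (-(luscherEps1 * lam / 2) / L) := by
    rw [Real.exp_le_exp, neg_div, neg_div, neg_le_neg_iff, div_le_div_iff_of_pos_right hL]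
    nlinarith
  have h0 : 0 ≤ levelValue su2Rep L β 0 := (levelValue_zero_su2Rep_pos L β).le
  rw [← levelValue_one, ← levelValue_zero]
  exact key.trans (mul_le_mul_of_nonneg_right hexp h0)

/-- **`ExplicitNoIntruder 1 → 0 < ε₁ → FemtoGapSU2`**: the fifth stub at the single level `k = 1` reaches the qualitative femto-gap leaf. [cite: Luscher1983] -/
theorem femtoGapSU2_of_explicitNoIntruder_one (h : ExplicitNoIntruder 1) (hε : 0 < luscherEps1) : FemtoGapSU2 :=
  femtoGapSU2_of_levelOne (levelValue_le_of_explicitNoIntruder 1 h) hε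

/-- Hence `(∀ k, ExplicitNoIntruder k) → 0 < ε₁ → FemtoGapSU2` (the registered stub's shape; only `k = 1` is used). [cite: Luscher1983] -/
theorem femtoGapSU2_of_explicit (h : ∀ k, ExplicitNoIntruder k) (hε : 0 < luscherEps1) : FemtoGapSU2 :=
  femtoGapSU2_of_explicitNoIntruder_one (h 1) hε

/-- The same with the tree's NAMED FACT `LuscherSimonGap` (discrete spectrum and `0 < ε₁` for Lüscher's Hamiltonian) supplying `0 < ε₁`, as in
`femtoGapSU2_of_ofRecord`. [cite: Luscher1983] [cite: SimonB1983DiscreteSpectrum, Cor. 4 p. 217] -/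
theorem femtoGapSU2_of_explicitNoIntruder_one_of_luscherSimonGap (hLS : LuscherSimonGap) (h : ExplicitNoIntruder 1) : FemtoGapSU2 :=
  femtoGapSU2_of_explicitNoIntruder_one h hLS.2

end Summit.QuantumFields.YangMills.Theorems.FemtoTransferGap

end
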